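import Mathlib.Analysis.Complex.Basic
import Mathlib.Topology.ContinuousOn
import HarnessLib

/-!
# THE TWO-SIDED DESCENT OVER PLACES, ABSTRACT BOOKKEEPING: per-place limit functionals peel one place at a time off an identity between two families of multi-place
# torus functions, accumulating each side's OWN constants (Rogawski 1990 §8.4 p. 127 «`3c_GΦ_ε(δ₀,φ) + 3c_{G′}Φ_ε(δ₃,φ) = 3c_G f(γ₀)`», §14.5 p. 239 «`f′_v(γ₀) = f_v(γ₀)` … from the
# limit formulas (cf. §8.4) if `v ∈ S₀`»)

Topic `NumberTheory/Automorphic`; namespace `Literature.NumberTheory.Automorphic`.  THEOREMS ONLY (no `def`, no instance, no notation, no axiom, no named fact, no `sorry`);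
Mathlib-only imports; no measure, no group — pure filter∕`Finset` bookkeeping.  Cell `pub/hodgecm-mathlib`, ENGINE T1 (crux H413 = `stmt-HodgeConjecture-24833`); ROAD-Sd residual R4,
SdArch ED. 3 node **N5 (abstract half)** «(D4)-abs» of F0P3a-p03 (g11)'s design census `CENSUS-SdArch-ED3-Design` (7141d221); co-hand F0P3a-p06 (g11) (LEAD WORD T8-141 (2)).
The rank-one ancestor is ★ p841432 `Automorphic/ArchEndoscopicCentralDescent` §3 (`apply_center_eq_zero_of_forall_sum_integral_pi_eq_zero`: ONE side, limits `= 0`); here TWO sides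
(`G` = the quasi-split `G_∞`, `G′` = the inner form `G′_∞`), limits `= c_w ·` (descended function) with EACH SIDE'S OWN per-place constant (`c_w` from the (L_{U(2,1)}) letter ★ p842205,
`c′_w = −12i·ν′_w(K)` from ★ p842193 at definite places), and NO linearity of the functional in the test function — only CONGRUENCE on the regular set and HOMOGENEITY (so the
`iteratedDeriv` side conditions of the concrete 8-ray functional `Λ₈` never enter: ★ p842285 `lambda8_iteratedDeriv_const_mul`, Mathlib `Filter.EventuallyEq.iteratedDeriv_eq`).

THE STATEMENT (`descent_two_sided_prod_mul_eq`).  Data: a finite index type `W` (the complex places), a space `X` of per-place torus parameters with its REGULAR set `R ⊆ X` and a base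
point `x₀` approachable from `R` (`(𝓝[R] x₀).NeBot`; the centre `(ζ,ζ,ζ)` and `{z | Injective z}`), per-place functionals `Λ_w : (X → ℂ) → X → ℂ` obeying
(congr) `f = g on R ⇒ Λ_w f = Λ_w g on R` and (hom) `Λ_w(a·f) = a·Λ_w f`; two families `G, G′ : Finset W → (W → X) → ℂ` («the multi-place function with the places in `S` live and
the others descended») with constants `c, c′ : W → ℂ`, the ONE-STEP limits
  `hstep : w₁ ∈ S → (z regular on S ∖ w₁) → Λ_{w₁}[y ↦ G_S(z[w₁ ↦ y])](x) → c_{w₁} · G_{S∖w₁}(z)` as `x → x₀` within `R` (and `hstep′` for `G′, c′`),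
and the TOP identity `hbase : G_univ = G′_univ` at every everywhere-regular `z` ((14.2.1) in Haar currency = node N4).  CONCLUSION: `(∏_w c_w) · G_∅(z) = (∏_w c′_w) · G′_∅(z)` for every `z`
— i.e. with `G_∅ = (mass)·a(ζ•1)`, `G′_∅ = (mass′)·a′(ζ•1)` the (S-d) central identity up to the POSITIVE REAL `∏_w c′_w∕c_w` that the `∃ν` of ★ `ArchCentralValueTransferExists` absorbs
(design census (D2)).  Proof: downward induction on `S` through `Q(S) : (∏_{w∉S} c_w)·G_S = (∏_{w∉S} c′_w)·G′_S` on `S`-regular points; the step applies `Λ_{w₁}` to both sides of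
`Q(S)` read as an identity of functions of the `w₁`-coordinate on `R` (congr + hom), and takes the two limits (`tendsto_nhds_unique_of_eventuallyEq`).
HONEST LABEL: HC_CM is proved only modulo the printed citations until rung 0 closes; this file is bookkeeping and pays nothing by itself.

## References
* [Rogawski1990] J. D. Rogawski, *Automorphic Representations of Unitary Groups in Three Variables*, Ann. of Math. Stud. 123 (1990), §8.4 p. 127, §14.5 p. 239.
-/

set_option autoImplicit false

namespace Literature.NumberTheory.Automorphic

open Filter Topology Set

section Descent

variable {W : Type*} [Fintype W] [DecidableEq W] {X : Type*} [TopologicalSpace X]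

/-- **ONE DESCENT STEP (two-sided).**  If `Q(insert w₁ S)` holds — `(∏_{w ∉ insert w₁ S} c_w)·G = (∏ … c′_w)·G′` at every point regular on `insert w₁ S` — and the one-step limits
at `w₁` hold on both sides, then `Q(S)` holds (`w₁ ∉ S`): apply `Λ_{w₁}` to both sides as functions of the `w₁`-coordinate on `R` (congruence + homogeneity) and compare the limits.
[cite: Rogawski1990, §8.4 p. 127] -/
theorem descent_two_sided_step (R : Set X) (x₀ : X) [(𝓝[R] x₀).NeBot]
    (Λ : W → (X → ℂ) → X → ℂ)
    (hΛcongr : ∀ (w : W) (f g : X → ℂ), EqOn f g R → EqOn (Λ w f) (Λ w g) R)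
    (hΛmul : ∀ (w : W) (a : ℂ) (f : X → ℂ) (x : X), Λ w (fun y => a * f y) x = a * Λ w f x)
    (G G' : Finset W → (W → X) → ℂ) (c c' : W → ℂ) (S : Finset W) (w₁ : W) (hw₁ : w₁ ∉ S)
    (hstep : ∀ z : W → X, (∀ w ∈ S, z w ∈ R) →
      Tendsto (fun x => Λ w₁ (fun y => G (insert w₁ S) (Function.update z w₁ y)) x) (𝓝[R] x₀) (𝓝 (c w₁ * G S z)))
    (hstep' : ∀ z : W → X, (∀ w ∈ S, z w ∈ R) →
      Tendsto (fun x => Λ w₁ (fun y => G' (insert w₁ S) (Function.update z w₁ y)) x) (𝓝[R] x₀) (𝓝 (c' w₁ * G' S z)))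
    (hQ : ∀ z : W → X, (∀ w ∈ insert w₁ S, z w ∈ R) →
      (∏ w ∈ (insert w₁ S)ᶜ, c w) * G (insert w₁ S) z = (∏ w ∈ (insert w₁ S)ᶜ, c' w) * G' (insert w₁ S) z)
    (z : W → X) (hz : ∀ w ∈ S, z w ∈ R) :
    (∏ w ∈ Sᶜ, c w) * G S z = (∏ w ∈ Sᶜ, c' w) * G' S z := by
  -- the two `w₁`-coordinate functions agree on `R`
  have hEq : EqOn (fun y => (∏ w ∈ (insert w₁ S)ᶜ, c w) * G (insert w₁ S) (Function.update z w₁ y))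
      (fun y => (∏ w ∈ (insert w₁ S)ᶜ, c' w) * G' (insert w₁ S) (Function.update z w₁ y)) R := by
    intro y hy
    refine hQ (Function.update z w₁ y) (fun w hw => ?_)
    rcases Finset.mem_insert.mp hw with rfl | hw
    · simpa using hy
    · have hne : w ≠ w₁ := fun h => hw₁ (h ▸ hw)
      simpa [Function.update_of_ne hne] using hz w hw
  -- apply `Λ_{w₁}`: congruence on `R`, then homogeneity
  have hEqΛ : ∀ᶠ x in 𝓝[R] x₀, (∏ w ∈ (insert w₁ S)ᶜ, c w) * Λ w₁ (fun y => G (insert w₁ S) (Function.update z w₁ y)) x =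
      (∏ w ∈ (insert w₁ S)ᶜ, c' w) * Λ w₁ (fun y => G' (insert w₁ S) (Function.update z w₁ y)) x := by
    refine eventually_nhdsWithin_of_forall fun x hx => ?_
    have h := hΛcongr w₁ _ _ hEq hx
    rw [hΛmul, hΛmul] at h
    exact h
  have hT := (hstep z hz).const_mul (∏ w ∈ (insert w₁ S)ᶜ, c w)
  have hT' := (hstep' z hz).const_mul (∏ w ∈ (insert w₁ S)ᶜ, c' w)
  have hlim := tendsto_nhds_unique_of_eventuallyEq hT hT' hEqΛ
  -- `Sᶜ = insert w₁ (insert w₁ S)ᶜ`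
  have hcompl : Sᶜ = insert w₁ (insert w₁ S)ᶜ := by
    rw [Finset.compl_insert, Finset.insert_erase (Finset.mem_compl.mpr hw₁)]
  have hnot : w₁ ∉ (insert w₁ S)ᶜ := by simp
  rw [hcompl, Finset.prod_insert hnot, Finset.prod_insert hnot]
  calc c w₁ * (∏ w ∈ (insert w₁ S)ᶜ, c w) * G S z = (∏ w ∈ (insert w₁ S)ᶜ, c w) * (c w₁ * G S z) := by ring
    _ = (∏ w ∈ (insert w₁ S)ᶜ, c' w) * (c' w₁ * G' S z) := hlim
    _ = c' w₁ * (∏ w ∈ (insert w₁ S)ᶜ, c' w) * G' S z := by ring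

/-- **THE TWO-SIDED DESCENT OVER PLACES (abstract bookkeeping).**  Per-place functionals `Λ_w` obeying congruence on the regular set `R` and homogeneity; two families
`G, G′ : Finset W → (W → X) → ℂ` with one-step limits `Λ_{w₁}[y ↦ G_S(z[w₁ ↦ y])] → c_{w₁}·G_{S∖w₁}(z)` (resp. `c′`) as `x → x₀` within `R`, for `w₁ ∈ S` and `z` regular on `S ∖ w₁`;
and the top identity `G_univ = G′_univ` at everywhere-regular points.  THEN `(∏_w c_w)·G_∅(z) = (∏_w c′_w)·G′_∅(z)` for every `z` — the (S-d) central identity up to the constant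
`∏_w c′_w ∕ c_w` (Rogawski p. 127: `3c_G Φ(δ₀) + 3c_{G′}Φ(δ₃) = 3c_G f(γ₀)` with `c_{G′} = 3c_G`; p. 239: «from the limit formulas if `v ∈ S₀`»).  No linearity of `Λ_w` in the test function is
assumed. [cite: Rogawski1990, §8.4 p. 127; §14.5 p. 239] -/
theorem descent_two_sided_prod_mul_eq (R : Set X) (x₀ : X) [(𝓝[R] x₀).NeBot]
    (Λ : W → (X → ℂ) → X → ℂ)
    (hΛcongr : ∀ (w : W) (f g : X → ℂ), EqOn f g R → EqOn (Λ w f) (Λ w g) R)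
    (hΛmul : ∀ (w : W) (a : ℂ) (f : X → ℂ) (x : X), Λ w (fun y => a * f y) x = a * Λ w f x)
    (G G' : Finset W → (W → X) → ℂ) (c c' : W → ℂ)
    (hstep : ∀ (S : Finset W) (w₁ : W), w₁ ∈ S → ∀ z : W → X, (∀ w ∈ S.erase w₁, z w ∈ R) →
      Tendsto (fun x => Λ w₁ (fun y => G S (Function.update z w₁ y)) x) (𝓝[R] x₀) (𝓝 (c w₁ * G (S.erase w₁) z)))
    (hstep' : ∀ (S : Finset W) (w₁ : W), w₁ ∈ S → ∀ z : W → X, (∀ w ∈ S.erase w₁, z w ∈ R) →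
      Tendsto (fun x => Λ w₁ (fun y => G' S (Function.update z w₁ y)) x) (𝓝[R] x₀) (𝓝 (c' w₁ * G' (S.erase w₁) z)))
    (hbase : ∀ z : W → X, (∀ w, z w ∈ R) → G Finset.univ z = G' Finset.univ z)
    (z : W → X) :
    (∏ w, c w) * G ∅ z = (∏ w, c' w) * G' ∅ z := by
  -- `Q(S)` by downward induction on the number of descended places `Sᶜ.card`
  have key : ∀ (k : ℕ) (S : Finset W), Sᶜ.card = k → ∀ z : W → X, (∀ w ∈ S, z w ∈ R) →
      (∏ w ∈ Sᶜ, c w) * G S z = (∏ w ∈ Sᶜ, c' w) * G' S z := by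
    intro k
    induction k with
    | zero =>
        intro S hS z hz
        have hSc : Sᶜ = ∅ := Finset.card_eq_zero.mp hS
        have hSu : S = Finset.univ := by
          have h := congrArg (fun T : Finset W => Tᶜ) hSc
          simpa using h
        subst hSu
        rw [Finset.compl_univ, Finset.prod_empty, Finset.prod_empty, one_mul, one_mul]
        exact hbase z (fun w => hz w (Finset.mem_univ w))
    | succ k ih =>
        intro S hS z hz
        obtain ⟨w₁, hw₁⟩ : Sᶜ.Nonempty := Finset.card_pos.mp (by omega)
        have hw₁S : w₁ ∉ S := Finset.mem_compl.mp hw₁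
        have hcard : (insert w₁ S)ᶜ.card = k := by
          rw [Finset.compl_insert, Finset.card_erase_of_mem hw₁, hS]
          rfl
        have herase : (insert w₁ S).erase w₁ = S := Finset.erase_insert hw₁S
        refine descent_two_sided_step R x₀ Λ hΛcongr hΛmul G G' c c' S w₁ hw₁S (fun z' hz' => ?_) (fun z' hz' => ?_) (ih (insert w₁ S) hcard) z hz
        · have h := hstep (insert w₁ S) w₁ (Finset.mem_insert_self w₁ S) z' (by rw [herase]; exact hz')
          rwa [herase] at h
        · have h := hstep' (insert w₁ S) w₁ (Finset.mem_insert_self w₁ S) z' (by rw [herase]; exact hz')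
          rwa [herase] at h
  have h := key ((∅ : Finset W)ᶜ.card) ∅ rfl z (fun w hw => absurd hw (Finset.notMem_empty w))
  simpa only [Finset.compl_empty] using h

end Descent

/-! ## ED. 2 (append-only): a PER-PLACE base point `x₀ : W → X` — the centre `ζ_w•1` differs from place to place (F0P3a-p03 (g11), N5 FILE A2 ★) -/

section DescentPerPlace

variable {W : Type*} [Fintype W] [DecidableEq W] {X : Type*} [TopologicalSpace X]

/-- **ONE DESCENT STEP (two-sided), per-place base point**: as `descent_two_sided_step` with the limit at `w₁` taken along `𝓝[R] (x₀ w₁)`. [cite: Rogawski1990, §8.4 p. 127] -/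
theorem descent_two_sided_step' (R : Set X) (x₀ : W → X) [∀ w, (𝓝[R] (x₀ w)).NeBot]
    (Λ : W → (X → ℂ) → X → ℂ)
    (hΛcongr : ∀ (w : W) (f g : X → ℂ), EqOn f g R → EqOn (Λ w f) (Λ w g) R)
    (hΛmul : ∀ (w : W) (a : ℂ) (f : X → ℂ) (x : X), Λ w (fun y => a * f y) x = a * Λ w f x)
    (G G' : Finset W → (W → X) → ℂ) (c c' : W → ℂ) (S : Finset W) (w₁ : W) (hw₁ : w₁ ∉ S)
    (hstep : ∀ z : W → X, (∀ w ∈ S, z w ∈ R) →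
      Tendsto (fun x => Λ w₁ (fun y => G (insert w₁ S) (Function.update z w₁ y)) x) (𝓝[R] (x₀ w₁)) (𝓝 (c w₁ * G S z)))
    (hstep' : ∀ z : W → X, (∀ w ∈ S, z w ∈ R) →
      Tendsto (fun x => Λ w₁ (fun y => G' (insert w₁ S) (Function.update z w₁ y)) x) (𝓝[R] (x₀ w₁)) (𝓝 (c' w₁ * G' S z)))
    (hQ : ∀ z : W → X, (∀ w ∈ insert w₁ S, z w ∈ R) →
      (∏ w ∈ (insert w₁ S)ᶜ, c w) * G (insert w₁ S) z = (∏ w ∈ (insert w₁ S)ᶜ, c' w) * G' (insert w₁ S) z)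
    (z : W → X) (hz : ∀ w ∈ S, z w ∈ R) :
    (∏ w ∈ Sᶜ, c w) * G S z = (∏ w ∈ Sᶜ, c' w) * G' S z := by
  have hEq : EqOn (fun y => (∏ w ∈ (insert w₁ S)ᶜ, c w) * G (insert w₁ S) (Function.update z w₁ y))
      (fun y => (∏ w ∈ (insert w₁ S)ᶜ, c' w) * G' (insert w₁ S) (Function.update z w₁ y)) R := by
    intro y hy
    refine hQ (Function.update z w₁ y) (fun w hw => ?_)
    rcases Finset.mem_insert.mp hw with rfl | hw
    · simpa using hy
    · have hne : w ≠ w₁ := fun h => hw₁ (h ▸ hw)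
      simpa [Function.update_of_ne hne] using hz w hw
  have hEqΛ : ∀ᶠ x in 𝓝[R] (x₀ w₁), (∏ w ∈ (insert w₁ S)ᶜ, c w) * Λ w₁ (fun y => G (insert w₁ S) (Function.update z w₁ y)) x =
      (∏ w ∈ (insert w₁ S)ᶜ, c' w) * Λ w₁ (fun y => G' (insert w₁ S) (Function.update z w₁ y)) x := by
    refine eventually_nhdsWithin_of_forall fun x hx => ?_
    have h := hΛcongr w₁ _ _ hEq hx
    rw [hΛmul, hΛmul] at h
    exact h
  have hT := (hstep z hz).const_mul (∏ w ∈ (insert w₁ S)ᶜ, c w)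
  have hT' := (hstep' z hz).const_mul (∏ w ∈ (insert w₁ S)ᶜ, c' w)
  have hlim := tendsto_nhds_unique_of_eventuallyEq hT hT' hEqΛ
  have hcompl : Sᶜ = insert w₁ (insert w₁ S)ᶜ := by
    rw [Finset.compl_insert, Finset.insert_erase (Finset.mem_compl.mpr hw₁)]
  have hnot : w₁ ∉ (insert w₁ S)ᶜ := by simp
  rw [hcompl, Finset.prod_insert hnot, Finset.prod_insert hnot]
  calc c w₁ * (∏ w ∈ (insert w₁ S)ᶜ, c w) * G S z = (∏ w ∈ (insert w₁ S)ᶜ, c w) * (c w₁ * G S z) := by ring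
    _ = (∏ w ∈ (insert w₁ S)ᶜ, c' w) * (c' w₁ * G' S z) := hlim
    _ = c' w₁ * (∏ w ∈ (insert w₁ S)ᶜ, c' w) * G' S z := by ring

/-- **THE TWO-SIDED DESCENT OVER PLACES, per-place base point** (the form N5 FILE A2 ★ `tendsto_lambda8_sum_integral_pi_update` instantiates: at the place `w₁` the limit is taken at the
centre `x₀ w₁ = ζ_{w₁}•1`, which varies with `w₁`): as `descent_two_sided_prod_mul_eq` with `x₀ : W → X` and `hstep`∕`hstep′` along `𝓝[R] (x₀ w₁)`.  CONCLUSION unchanged: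
`(∏_w c_w)·G_∅(z) = (∏_w c′_w)·G′_∅(z)`. [cite: Rogawski1990, §8.4 p. 127; §14.5 p. 239] -/
theorem descent_two_sided_prod_mul_eq' (R : Set X) (x₀ : W → X) [∀ w, (𝓝[R] (x₀ w)).NeBot]
    (Λ : W → (X → ℂ) → X → ℂ)
    (hΛcongr : ∀ (w : W) (f g : X → ℂ), EqOn f g R → EqOn (Λ w f) (Λ w g) R)
    (hΛmul : ∀ (w : W) (a : ℂ) (f : X → ℂ) (x : X), Λ w (fun y => a * f y) x = a * Λ w f x)
    (G G' : Finset W → (W → X) → ℂ) (c c' : W → ℂ)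
    (hstep : ∀ (S : Finset W) (w₁ : W), w₁ ∈ S → ∀ z : W → X, (∀ w ∈ S.erase w₁, z w ∈ R) →
      Tendsto (fun x => Λ w₁ (fun y => G S (Function.update z w₁ y)) x) (𝓝[R] (x₀ w₁)) (𝓝 (c w₁ * G (S.erase w₁) z)))
    (hstep' : ∀ (S : Finset W) (w₁ : W), w₁ ∈ S → ∀ z : W → X, (∀ w ∈ S.erase w₁, z w ∈ R) →
      Tendsto (fun x => Λ w₁ (fun y => G' S (Function.update z w₁ y)) x) (𝓝[R] (x₀ w₁)) (𝓝 (c' w₁ * G' (S.erase w₁) z)))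
    (hbase : ∀ z : W → X, (∀ w, z w ∈ R) → G Finset.univ z = G' Finset.univ z)
    (z : W → X) :
    (∏ w, c w) * G ∅ z = (∏ w, c' w) * G' ∅ z := by
  have key : ∀ (k : ℕ) (S : Finset W), Sᶜ.card = k → ∀ z : W → X, (∀ w ∈ S, z w ∈ R) →
      (∏ w ∈ Sᶜ, c w) * G S z = (∏ w ∈ Sᶜ, c' w) * G' S z := by
    intro k
    induction k with
    | zero =>
        intro S hS z hz
        have hSc : Sᶜ = ∅ := Finset.card_eq_zero.mp hS
        have hSu : S = Finset.univ := by
          have h := congrArg (fun T : Finset W => Tᶜ) hSc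
          simpa using h
        subst hSu
        rw [Finset.compl_univ, Finset.prod_empty, Finset.prod_empty, one_mul, one_mul]
        exact hbase z (fun w => hz w (Finset.mem_univ w))
    | succ k ih =>
        intro S hS z hz
        obtain ⟨w₁, hw₁⟩ : Sᶜ.Nonempty := Finset.card_pos.mp (by omega)
        have hw₁S : w₁ ∉ S := Finset.mem_compl.mp hw₁
        have hcard : (insert w₁ S)ᶜ.card = k := by
          rw [Finset.compl_insert, Finset.card_erase_of_mem hw₁, hS]
          rfl
        have herase : (insert w₁ S).erase w₁ = S := Finset.erase_insert hw₁S
        refine descent_two_sided_step' R x₀ Λ hΛcongr hΛmul G G' c c' S w₁ hw₁S (fun z' hz' => ?_) (fun z' hz' => ?_) (ih (insert w₁ S) hcard) z hz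
        · have h := hstep (insert w₁ S) w₁ (Finset.mem_insert_self w₁ S) z' (by rw [herase]; exact hz')
          rwa [herase] at h
        · have h := hstep' (insert w₁ S) w₁ (Finset.mem_insert_self w₁ S) z' (by rw [herase]; exact hz')
          rwa [herase] at h
  have h := key ((∅ : Finset W)ᶜ.card) ∅ rfl z (fun w hw => absurd hw (Finset.notMem_empty w))
  simpa only [Finset.compl_empty] using h

end DescentPerPlace

end Literature.NumberTheory.Automorphic
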